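import Literature.AlgebraicGeometry.Resolution.ArithmeticalThreefoldsMonomialsDet
import Literature.AlgebraicGeometry.Resolution.LocalBlowup
import HarnessLib

/-!
# Cossart–Piltant 2019, Prop. 4.8: (LU) for `A` from the final state of Lemma 4.7, FRAME form

Topic: `Literature/AlgebraicGeometry/Resolution` (proofs only; no new notions, no new named
facts). `exists_adjoin_isRegularLocalRing_of_lemma47State_of_det`
(`ArithmeticalThreefoldsMonomialsDet.lean`) concludes Cossart–Piltant's descent (J. Algebra 529
(2019) = arXiv:1412.0868, proof of Prop. 4.8, arXiv v1 Prop. 4.6 pp. 52–53) from the final state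
of Lemma 4.7 for an ABSTRACT local `Â`-algebra `S`. The monoidal engines that produce this state
(`head_conclusion_of_principalized_within'`, `Prop81MiddleAssemblyWithinDvd.lean`) work in the
FRAME: their models are the subrings `locAtCentre (S₀[t]) O' ⊆ K̂₁` over a base ring `S₀` (here:
an `Â`-algebra mapping to `K̂₁`), with regular parameters `x' : Fin 3 → locAtCentre …`, the first
`r'` of which carry the monomials. This file does the conversion once and for all:

* `exists_adjoin_isRegularLocalRing_of_lemma47Frame` — (LU) for `A` at `v` from: a frame model
  `R = locAtCentre (S₀[t]) O'` which is a regular local ring with regular parameters `x'`,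
  `0 < r' ≤ 3`, the images of `𝔪_A` divisible by `x'₁ ⋯ x'_{r'}`, elements `f'ᵢ ∈ K` which are
  units times monomials in `x'₁, …, x'_{r'}` with nonsingular exponent matrix, and shape
  elements `b_c ∈ Â` for the complementary parameters `x'_c`, `c ≥ r'` (from (510)). The
  `Â`-algebra structure, locality, essential finiteness (`R` is a localization of the finitely
  generated `S₀[t]`) and the splitting `x' = (u, x)` are supplied here.

## Sources

* V. Cossart, O. Piltant, J. Algebra 529 (2019) 268–535 = arXiv:1412.0868, proof of Prop. 4.8
  with Lemma 4.7 and (510)–(512) (arXiv v1: Prop. 4.6, pp. 52–53). [CossartPiltant2019]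
-/

noncomputable section

namespace Literature.AlgebraicGeometry.Resolution

universe u

open IsLocalRing

section Lemma47Frame

variable {A : Type u} [CommRing A] [IsDomain A] [IsLocalRing A] [IsNoetherianRing A]
  {K : Type u} [Field K] [Algebra A K] [IsFractionRing A K]

set_option maxHeartbeats 800000 in
/-- **(LU) for `A` at `v` from the final state of Lemma 4.7, in the frame of the monoidal
engines.** Let `A` be a Noetherian local domain essentially of finite type over a field `k` with
fraction field `K` and a valuation ring `O` of `K` centred on `𝔪_A`; `K̂₁` a field under `Â` with kernel
a minimal prime and `K̂₁ = QF(Â/P̂₁)`; `ι : K → K̂₁` compatible with `A → Â`; `O'` a valuation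
ring of `K̂₁` with residue field algebraic over that of `Â` and `O' ∩ K = O`; `S₀` an `Â`-algebra,
essentially of finite type, mapping to `K̂₁` compatibly. Let `t ⊆ K̂₁` be finite with
`S₀[t] ⊆ O'` and `R = locAtCentre (S₀[t]) O'` a regular local ring with regular parameters
`x'₁, x'₂, x'₃`, and `0 < r' ≤ 3`, such that: the images of the elements of `𝔪_A` lie in
`(x'₁ ⋯ x'_{r'})` (Lemma 4.7: `√(m_Â 𝒪_{Ŷ,ŷ}) = (û₁ ⋯ û_r)`); there are `f'₁, …, f'_{r'} ∈ K`
whose images are units of `R` times monomials in `x'₁, …, x'_{r'}` with nonsingular exponent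
matrix (the output of the loops `E = F`, `♯E ≤ r`); and every complementary parameter `x'_c`,
`c ≥ r'`, is reached by an element `b_c ∈ Â` of the shape `unit · monomial(x'_{<r'}) · x'_c`
((510)). Then some finitely generated `A[t] ⊆ O` is regular at the centre of `O` — (LU) for `A`
at `v`. Proof: `R` as an `Â`-algebra (local, essentially of finite type, in `K̂₁`), and
`exists_adjoin_isRegularLocalRing_of_lemma47State_of_det`.
[cite: CossartPiltant2019, proof of Prop. 4.8 with Lemma 4.7 and (510)–(512) (arXiv v1: Prop. 4.6, pp. 52–53)] -/
theorem exists_adjoin_isRegularLocalRing_of_lemma47Frame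
    (k : Type u) [Field k] [Algebra k A] [Algebra.EssFiniteType k A]
    (O : ValuationSubring K)
    (hdom : ∀ x ∈ maximalIdeal A, O.valuation (algebraMap A K x) < 1)
    {K₁ : Type u} [Field K₁] [Algebra (AdicCompletion (maximalIdeal A) A) K₁]
    (hP₁ : RingHom.ker (algebraMap (AdicCompletion (maximalIdeal A) A) K₁) ∈
      minimalPrimes (AdicCompletion (maximalIdeal A) A))
    (hK₁ : ∀ z : K₁, ∃ a b : AdicCompletion (maximalIdeal A) A,
      z = algebraMap _ K₁ a / algebraMap _ K₁ b)
    (ι : K →+* K₁) (hι : ι.comp (algebraMap A K) =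
      (algebraMap (AdicCompletion (maximalIdeal A) A) K₁).comp
        (algebraMap A (AdicCompletion (maximalIdeal A) A)))
    (O' : ValuationSubring K₁)
    (halgO' : ∀ y : O', ∃ p : Polynomial (AdicCompletion (maximalIdeal A) A),
      (∃ i, p.coeff i ∉ (maximalIdeal A).map (algebraMap A (AdicCompletion (maximalIdeal A) A))) ∧
      O'.valuation (p.eval₂ (algebraMap (AdicCompletion (maximalIdeal A) A) K₁) y) < 1)
    (hO : O'.comap ι = O)
    -- the frame base
    {S₀ : Type u} [CommRing S₀] [Algebra (AdicCompletion (maximalIdeal A) A) S₀]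
    [Algebra.EssFiniteType (AdicCompletion (maximalIdeal A) A) S₀] [Algebra S₀ K₁]
    [IsScalarTower (AdicCompletion (maximalIdeal A) A) S₀ K₁]
    -- the final model and its regular parameters
    (t : Finset K₁) (hTO : (Algebra.adjoin S₀ (t : Set K₁)).toSubring ≤ O'.toSubring)
    (hreg : IsRegularLocalRing (locAtCentre (Algebra.adjoin S₀ (t : Set K₁)).toSubring O'))
    (x' : Fin 3 → locAtCentre (Algebra.adjoin S₀ (t : Set K₁)).toSubring O')
    (hx0 : ∀ j, (x' j : K₁) ≠ 0)
    (hspan : haveI := isLocalRing_locAtCentre hTO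
      Ideal.span (Set.range x') = maximalIdeal _)
    (r' : ℕ) (hr' : r' ≤ 3) (hr0 : 0 < r')
    -- `m_A R ⊆ (x'₁ ⋯ x'_{r'})`
    (hq : ∀ (a : A) (y : locAtCentre (Algebra.adjoin S₀ (t : Set K₁)).toSubring O'),
      a ∈ maximalIdeal A → (y : K₁) = ι (algebraMap A K a) →
        y ∈ Ideal.span {∏ i : Fin r', x' (Fin.castLE hr' i)})
    -- the monomials `f'ᵢ ∈ K`
    (f' : Fin r' → K)
    (γ' : Fin r' → (locAtCentre (Algebra.adjoin S₀ (t : Set K₁)).toSubring O')ˣ)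
    (a' : Matrix (Fin r') (Fin r') ℕ)
    (hf' : ∀ i, ι (f' i) =
      ((γ' i : locAtCentre (Algebra.adjoin S₀ (t : Set K₁)).toSubring O') : K₁) *
        ∏ j, ((x' (Fin.castLE hr' j) :
          locAtCentre (Algebra.adjoin S₀ (t : Set K₁)).toSubring O') : K₁) ^ a' i j)
    (hdet : (a'.map (fun n : ℕ => (n : ℤ))).det ≠ 0)
    -- the shape elements of the complementary parameters
    (hshape : ∀ c : Fin 3, r' ≤ (c : ℕ) →
      ∃ (b : AdicCompletion (maximalIdeal A) A)
        (ε : (locAtCentre (Algebra.adjoin S₀ (t : Set K₁)).toSubring O')ˣ) (m : Fin r' → ℕ),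
        algebraMap _ K₁ b =
          ((ε : locAtCentre (Algebra.adjoin S₀ (t : Set K₁)).toSubring O') : K₁) *
            (∏ j, ((x' (Fin.castLE hr' j) :
              locAtCentre (Algebra.adjoin S₀ (t : Set K₁)).toSubring O') : K₁) ^ m j) *
            (x' c : K₁)) :
    ∃ (s : Finset K) (h : (Algebra.adjoin A (s : Set K)).toSubring ≤ O.toSubring),
      IsRegularLocalRing (Localization.AtPrime
        (Ideal.comap (Subring.inclusion h) (maximalIdeal O))) := by
  classical
  haveI := isLocalRing_locAtCentre hTO
  haveI : IsRegularLocalRing (locAtCentre (Algebra.adjoin S₀ (t : Set K₁)).toSubring O') := hreg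
  have hRO : (locAtCentre (Algebra.adjoin S₀ (t : Set K₁)).toSubring O') ≤ O'.toSubring :=
    locAtCentre_le hTO
  have hιA : ∀ a : A, algebraMap (AdicCompletion (maximalIdeal A) A) K₁
      (algebraMap A (AdicCompletion (maximalIdeal A) A) a) = ι (algebraMap A K a) := fun a => by
    have := RingHom.congr_fun hι a
    simpa only [RingHom.comp_apply] using this.symm
  -- `(locAtCentre (Algebra.adjoin S₀ (t : Set K₁)).toSubring O')` as an `S₀`-algebra and as an `Â`-algebra inside `K̂₁`
  have hS₀T : ∀ s : S₀, algebraMap S₀ K₁ s ∈ (Algebra.adjoin S₀ (t : Set K₁)) := fun s => (Algebra.adjoin S₀ (t : Set K₁)).algebraMap_mem s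
  have hS₀R : ∀ s : S₀, algebraMap S₀ K₁ s ∈ (locAtCentre (Algebra.adjoin S₀ (t : Set K₁)).toSubring O') := fun s => le_locAtCentre _ _ (hS₀T s)
  letI algS₀R : Algebra S₀ (locAtCentre (Algebra.adjoin S₀ (t : Set K₁)).toSubring O') := ((algebraMap S₀ K₁).codRestrict (locAtCentre (Algebra.adjoin S₀ (t : Set K₁)).toSubring O') hS₀R).toAlgebra
  have hS₀Rval : ∀ s : S₀, ((algebraMap S₀ (locAtCentre (Algebra.adjoin S₀ (t : Set K₁)).toSubring O') s : (locAtCentre (Algebra.adjoin S₀ (t : Set K₁)).toSubring O')) : K₁) = algebraMap S₀ K₁ s := fun _ => rfl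
  letI algAhR : Algebra (AdicCompletion (maximalIdeal A) A) (locAtCentre (Algebra.adjoin S₀ (t : Set K₁)).toSubring O') := ((algebraMap S₀ (locAtCentre (Algebra.adjoin S₀ (t : Set K₁)).toSubring O')).comp (algebraMap (AdicCompletion (maximalIdeal A) A) S₀)).toAlgebra
  haveI : IsScalarTower (AdicCompletion (maximalIdeal A) A) S₀ (locAtCentre (Algebra.adjoin S₀ (t : Set K₁)).toSubring O') := IsScalarTower.of_algebraMap_eq fun _ => rfl
  have hAhRval : ∀ a : (AdicCompletion (maximalIdeal A) A), ((algebraMap (AdicCompletion (maximalIdeal A) A) (locAtCentre (Algebra.adjoin S₀ (t : Set K₁)).toSubring O') a : (locAtCentre (Algebra.adjoin S₀ (t : Set K₁)).toSubring O')) : K₁) = algebraMap (AdicCompletion (maximalIdeal A) A) K₁ a := fun a => by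
    change algebraMap S₀ K₁ (algebraMap (AdicCompletion (maximalIdeal A) A) S₀ a) = _
    rw [← IsScalarTower.algebraMap_apply]
  haveI : IsScalarTower (AdicCompletion (maximalIdeal A) A) (locAtCentre (Algebra.adjoin S₀ (t : Set K₁)).toSubring O') K₁ := IsScalarTower.of_algebraMap_eq fun a => (hAhRval a).symm
  haveI : IsScalarTower S₀ (locAtCentre (Algebra.adjoin S₀ (t : Set K₁)).toSubring O') K₁ := IsScalarTower.of_algebraMap_eq fun s => (hS₀Rval s).symm
  -- `(locAtCentre (Algebra.adjoin S₀ (t : Set K₁)).toSubring O')` is essentially of finite type over `S₀` (a localization of `S₀[t]`), hence over `Â`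
  haveI : Algebra.EssFiniteType S₀ (locAtCentre (Algebra.adjoin S₀ (t : Set K₁)).toSubring O') := by
    rw [Algebra.essFiniteType_iff]
    -- the generators `t`, seen in `(locAtCentre (Algebra.adjoin S₀ (t : Set K₁)).toSubring O')`
    let σ : Finset (locAtCentre (Algebra.adjoin S₀ (t : Set K₁)).toSubring O') := Finset.univ.image fun z : t =>
      (⟨(z : K₁), le_locAtCentre _ _ (Algebra.subset_adjoin z.2)⟩ : (locAtCentre (Algebra.adjoin S₀ (t : Set K₁)).toSubring O'))
    have hσ : (IsScalarTower.toAlgHom S₀ (locAtCentre (Algebra.adjoin S₀ (t : Set K₁)).toSubring O') K₁) '' (σ : Set (locAtCentre (Algebra.adjoin S₀ (t : Set K₁)).toSubring O')) = (t : Set K₁) := by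
      ext z
      simp only [σ, Finset.coe_image, Finset.coe_univ, Set.image_univ, Set.mem_image,
        Set.mem_range, IsScalarTower.coe_toAlgHom', Finset.mem_coe]
      constructor
      · rintro ⟨y, ⟨w, rfl⟩, rfl⟩; exact w.2
      · intro hz; exact ⟨⟨z, _⟩, ⟨⟨z, hz⟩, rfl⟩, rfl⟩
    have hmap : (Algebra.adjoin S₀ (σ : Set (locAtCentre (Algebra.adjoin S₀ (t : Set K₁)).toSubring O'))).map (IsScalarTower.toAlgHom S₀ (locAtCentre (Algebra.adjoin S₀ (t : Set K₁)).toSubring O') K₁) = (Algebra.adjoin S₀ (t : Set K₁)) := by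
      rw [← Algebra.adjoin_image, hσ]
    -- every element of `(Algebra.adjoin S₀ (t : Set K₁))` comes from `adjoin S₀ σ`
    have hlift : ∀ P : K₁, P ∈ (Algebra.adjoin S₀ (t : Set K₁)) → ∃ P' : (locAtCentre (Algebra.adjoin S₀ (t : Set K₁)).toSubring O'), P' ∈ Algebra.adjoin S₀ (σ : Set (locAtCentre (Algebra.adjoin S₀ (t : Set K₁)).toSubring O')) ∧ (P' : K₁) = P := by
      intro P hP
      rw [← hmap] at hP
      obtain ⟨P', hP', hPP'⟩ := Subalgebra.mem_map.mp hP
      exact ⟨P', hP', hPP'⟩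
    refine ⟨σ, fun s => ?_⟩
    obtain ⟨P, hP, Q, hQ, hvQ, hs⟩ := s.2
    obtain ⟨P', hP', hPP'⟩ := hlift P hP
    obtain ⟨Q', hQ', hQQ'⟩ := hlift Q hQ
    have hQ0 : Q ≠ 0 := ne_zero_of_valuation_eq_one hvQ
    have hQ'unit : IsUnit Q' := by
      by_contra hnu
      have := (not_isUnit_locAtCentre_iff hTO Q').mp hnu
      rw [hQQ', hvQ] at this
      exact lt_irrefl _ this
    refine ⟨Q', hQ', hQ'unit, ?_⟩
    have hsQ : s * Q' = P' := Subtype.ext (by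
      change (s : K₁) * (Q' : K₁) = (P' : K₁)
      rw [hQQ', hPP', hs, div_mul_cancel₀ _ hQ0])
    rw [hsQ]; exact hP'
  haveI : Algebra.EssFiniteType (AdicCompletion (maximalIdeal A) A) (locAtCentre (Algebra.adjoin S₀ (t : Set K₁)).toSubring O') := Algebra.EssFiniteType.comp (AdicCompletion (maximalIdeal A) A) S₀ (locAtCentre (Algebra.adjoin S₀ (t : Set K₁)).toSubring O')
  -- domination: `𝔪_A`, hence `𝔪_Â = 𝔪_A Â`, maps into `𝔪_R`
  have hdomR : ∀ s : (locAtCentre (Algebra.adjoin S₀ (t : Set K₁)).toSubring O'), s ∈ maximalIdeal (locAtCentre (Algebra.adjoin S₀ (t : Set K₁)).toSubring O') ↔ O'.valuation (s : K₁) < 1 :=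
    fun s => mem_maximalIdeal_locAtCentre_iff hTO s
  have hequiv : O.valuation.IsEquiv (O'.valuation.comap ι) := by
    rw [Valuation.isEquiv_iff_valuationSubring, ValuationSubring.valuationSubring_valuation]
    ext z
    rw [Valuation.mem_valuationSubring_iff, Valuation.comap_apply,
      ValuationSubring.valuation_le_one_iff, ← ValuationSubring.mem_comap, hO]
  have hmA : (maximalIdeal A).map (algebraMap A (AdicCompletion (maximalIdeal A) A)) ≤ (maximalIdeal (locAtCentre (Algebra.adjoin S₀ (t : Set K₁)).toSubring O')).comap (algebraMap (AdicCompletion (maximalIdeal A) A) (locAtCentre (Algebra.adjoin S₀ (t : Set K₁)).toSubring O')) := by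
    rw [Ideal.map_le_iff_le_comap]
    intro a ha
    rw [Ideal.mem_comap, Ideal.mem_comap, hdomR, hAhRval, hιA]
    have h1 : O.valuation (algebraMap A K a) < O.valuation 1 := by rw [map_one]; exact hdom a ha
    have h2 := (hequiv.lt_iff_lt).mp h1
    simpa only [Valuation.comap_apply, map_one] using h2
  haveI : IsLocalHom (algebraMap (AdicCompletion (maximalIdeal A) A) (locAtCentre (Algebra.adjoin S₀ (t : Set K₁)).toSubring O')) := by
    refine ⟨fun a ha => ?_⟩
    by_contra hna
    have hmem : a ∈ maximalIdeal (AdicCompletion (maximalIdeal A) A) := hna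
    rw [AdicCompletion.maximalIdeal_eq_map] at hmem
    exact (hmA hmem) |> fun h => (Ideal.mem_comap.mp h) |> fun h' =>
      (IsLocalRing.mem_maximalIdeal _ |>.mp h') ha
  -- the data in `(locAtCentre (Algebra.adjoin S₀ (t : Set K₁)).toSubring O')`
  have hSK₁ : Function.Injective (algebraMap (locAtCentre (Algebra.adjoin S₀ (t : Set K₁)).toSubring O') K₁) := Subtype.val_injective
  have hSO' : ∀ s : (locAtCentre (Algebra.adjoin S₀ (t : Set K₁)).toSubring O'), algebraMap (locAtCentre (Algebra.adjoin S₀ (t : Set K₁)).toSubring O') K₁ s ∈ O' := fun s => hRO s.2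
  have hdomS : ∀ s ∈ maximalIdeal (locAtCentre (Algebra.adjoin S₀ (t : Set K₁)).toSubring O'), O'.valuation (algebraMap (locAtCentre (Algebra.adjoin S₀ (t : Set K₁)).toSubring O') K₁ s) < 1 :=
    fun s hs => (hdomR s).mp hs
  -- splitting `x' = (u, x)`
  set e : ℕ := 3 - r' with he
  let u : Fin r' → (locAtCentre (Algebra.adjoin S₀ (t : Set K₁)).toSubring O') := fun j => x' (Fin.castLE hr' j)
  let x : Fin e → (locAtCentre (Algebra.adjoin S₀ (t : Set K₁)).toSubring O') := fun i => x' ⟨r' + i, by omega⟩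
  have hu0 : ∀ j, u j ≠ 0 := fun j h0 => hx0 _ (by
    change ((u j : (locAtCentre (Algebra.adjoin S₀ (t : Set K₁)).toSubring O')) : K₁) = 0
    rw [h0]; rfl)
  have hrange : Set.range u ∪ Set.range x = Set.range x' := by
    ext y
    constructor
    · rintro (⟨j, rfl⟩ | ⟨i, rfl⟩)
      · exact ⟨_, rfl⟩
      · exact ⟨_, rfl⟩
    · rintro ⟨c, rfl⟩
      by_cases hc : (c : ℕ) < r'
      · left
        refine ⟨⟨c, hc⟩, ?_⟩
        change x' (Fin.castLE hr' ⟨c, hc⟩) = x' c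
        congr 1
      · right
        have hc' : r' ≤ (c : ℕ) := not_lt.mp hc
        refine ⟨⟨(c : ℕ) - r', by omega⟩, ?_⟩
        change x' ⟨r' + ((c : ℕ) - r'), _⟩ = x' c
        congr 1
        ext
        simp only
        omega
  have hspan' : Ideal.span (Set.range u ∪ Set.range x) = maximalIdeal (locAtCentre (Algebra.adjoin S₀ (t : Set K₁)).toSubring O') := by
    rw [hrange]; exact hspan
  have hq' : ∀ a ∈ maximalIdeal A, algebraMap (AdicCompletion (maximalIdeal A) A) (locAtCentre (Algebra.adjoin S₀ (t : Set K₁)).toSubring O') (algebraMap A (AdicCompletion (maximalIdeal A) A) a) ∈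
      Ideal.span {∏ j, u j} := by
    intro a ha
    exact hq a _ ha (by rw [hAhRval, hιA])
  have hf'' : ∀ i, ι (f' i) = algebraMap (locAtCentre (Algebra.adjoin S₀ (t : Set K₁)).toSubring O') K₁ ((γ' i : (locAtCentre (Algebra.adjoin S₀ (t : Set K₁)).toSubring O')) * ∏ j, u j ^ a' i j) := by
    intro i
    rw [hf' i]
    change _ = (((γ' i : (locAtCentre (Algebra.adjoin S₀ (t : Set K₁)).toSubring O')) *
      ∏ j, u j ^ a' i j : (locAtCentre (Algebra.adjoin S₀ (t : Set K₁)).toSubring O')) : K₁)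
    simp only [u, Subring.coe_mul, SubmonoidClass.coe_finsetProd, SubmonoidClass.coe_pow]
  -- the shape elements, in `(locAtCentre (Algebra.adjoin S₀ (t : Set K₁)).toSubring O')`
  have hshape' : ∀ i : Fin e, ∃ (b : (AdicCompletion (maximalIdeal A) A)) (ε : (locAtCentre (Algebra.adjoin S₀ (t : Set K₁)).toSubring O')ˣ) (m : Fin r' → ℕ),
      algebraMap (AdicCompletion (maximalIdeal A) A) (locAtCentre (Algebra.adjoin S₀ (t : Set K₁)).toSubring O') b = (ε : (locAtCentre (Algebra.adjoin S₀ (t : Set K₁)).toSubring O')) * (∏ j, u j ^ m j) * x i := by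
    intro i
    obtain ⟨b, ε, m, hb⟩ := hshape ⟨r' + i, by omega⟩ (by simp)
    refine ⟨b, ε, m, Subtype.ext ?_⟩
    rw [hAhRval, hb]
    simp only [u, x, Subring.coe_mul, SubmonoidClass.coe_finsetProd, SubmonoidClass.coe_pow]
  choose bsh ε m hbsh using hshape'
  exact exists_adjoin_isRegularLocalRing_of_lemma47State_of_det k hP₁ hK₁ ι hι O' halgO' O hO
    (S := (locAtCentre (Algebra.adjoin S₀ (t : Set K₁)).toSubring O')) hSK₁ hSO' hdomS hr0 u hu0 x hspan' hq' f' γ' a' hf'' hdet bsh ε m hbsh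

end Lemma47Frame

end Literature.AlgebraicGeometry.Resolution

end
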